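import Literature.NumberTheory.EllipticCurves.IwasawaDualFunctorialityProofs
import Literature.NumberTheory.EllipticCurves.BigRepModuleShapiroDualityProofs
import Literature.NumberTheory.EllipticCurves.IwasawaSelmerDualEisensteinQuotientProofs
import HarnessLib

/-!
# An additive map `ι : B → S` from an honest `Λ`-module into the `S`-side of a dual pair that intertwines `T` with `ψ`
# is `Λ`-compatible: `⟨f • x, ι b⟩ = ⟨x, ι (f • b)⟩` for every `f ∈ Λ = ℤ_p⟦T⟧` — proofs file

Topic `NumberTheory/EllipticCurves` (sequel to `IwasawaDualFunctorialityProofs` / `IwasawaNakayamaProofs`: the axiomatic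
dual pairs `IwasawaDual.IsDualPair p ψ toDual` and their truncation lemmas). THEOREMS ONLY: no definition, no named fact,
no instance, no `sorry`.

WHY (cell `pub/bsd-print-x9`, shared μ-crux `MuInequalityCoherentPair{OfHoward,OfPrint}`, STUB B `stub_controlGlue`, DISCRETE
half, seat `bsd-line-x10b-p1-w2` g10, claim (DG3)). The dual control map `h : X/q_m X → Hom(B, ℚ/ℤ)` of
`WeierstrassCurve.SelmerDualData.exists_linearMap_quotSMulTop_qm_characterModule` (p643117) asks for the `Λ`-compatibility
`hιΛ : ∀ f x b, toDual (f • x) (ι b) = toDual x (ι (f • b))` of the comparison `ι : B → Sel_{p^∞}(E/K_∞)`; the readout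
of Howard's discrete module supplies only `ι (T • b) = (conj_γ − 1)(ι b)` (levelwise). This file closes the gap ONCE,
for any dual pair: an ADDITIVE `ι` with `ι (T • b) = ψ (ι b)` on a `Λ`-module `B` whose elements are killed by powers of
`p` and of `T` is `Λ`-compatible — a power series acts on `ι b ∈ S_N` through its truncation
(`IsDualPair.toDual_smul_eq_toDual_trunc_smul`) and on `b` through the same truncation (`X^N ∣ f − trunc_N f`), and on
monomials both sides are `(c mod p^N) • ⟨x, ψ^j (ι b)⟩` (`IsDualPair.toDual_monomial_smul`,
`PowerSeries.C_smul_eq_val_smul_of_pow_smul_eq_zero`).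

* `IsDualPair.apply_X_pow_smul_of_X_compat` — `ι (T^j • b) = ψ^j (ι b)`;
* `IsDualPair.toDual_coe_polynomial_smul_apply_eq` — the identity for polynomials `P` on `p^N`-torsion `b`;
* **`IsDualPair.toDual_smul_apply_eq_of_X_compat`** — the identity for every `f ∈ Λ`;
* **`WeierstrassCurve.SelmerDualData.toDual_smul_apply_eq_of_X_compat`** — the instance for `X(E/K_∞) ↔ Sel_{p^∞}(E/K_∞)`,
  `ψ = conj_γ − 1` (`SelmerDualData.isDualPair`): verbatim the hypothesis `hιΛ` of p643117.

References: [GreenbergLNM1716] §1 p. 60 (the Pontryagin dual as a `Λ`-module); [Lang1990] Ch. 5 §1 (power series act on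
`p`-power-torsion through truncations).  BSD is not proved by any of this.
-/

set_option autoImplicit false

noncomputable section

namespace Literature.NumberTheory.EllipticCurves.IwasawaDual.IsDualPair

variable {p : ℕ} [Fact p.Prime]
variable {S : Type*} [AddCommGroup S] {ψ : AddMonoid.End S}
variable {X : Type*} [AddCommGroup X] [Module (PowerSeries ℤ_[p]) X]
variable {toDual : X →+ (S →+ AddCircle (1 : ℚ))}
variable {B : Type*} [AddCommGroup B] [Module (PowerSeries ℤ_[p]) B] (ι : B →+ S)

/-- `ι (T^j • b) = ψ^j (ι b)` when `ι (T • b) = ψ (ι b)`. [cite: GreenbergLNM1716, §1 p. 60] -/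
theorem apply_X_pow_smul_of_X_compat (hT : ∀ b : B, ι ((PowerSeries.X : PowerSeries ℤ_[p]) • b) = ψ (ι b))
    (j : ℕ) (b : B) : ι ((PowerSeries.X : PowerSeries ℤ_[p]) ^ j • b) = (ψ ^ j) (ι b) := by
  induction j generalizing b with
  | zero => rw [pow_zero, one_smul, pow_zero, AddMonoid.End.one_apply]
  | succ j ih => rw [pow_succ, mul_smul, ih, hT, pow_succ, AddMonoid.End.coe_mul, Function.comp_apply]

/-- **The identity for polynomials**: `⟨P • x, ι b⟩ = ⟨x, ι (P • b)⟩` for `P ∈ ℤ_p[T]` and `p^N • b = 0`.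
[cite: GreenbergLNM1716, §1 p. 60] [cite: Lang1990, Ch. 5 §1] -/
theorem toDual_coe_polynomial_smul_apply_eq (h : IsDualPair p ψ toDual)
    (hT : ∀ b : B, ι ((PowerSeries.X : PowerSeries ℤ_[p]) • b) = ψ (ι b))
    {N : ℕ} (P : Polynomial ℤ_[p]) (x : X) (b : B) (hb : p ^ N • b = 0) :
    toDual ((P : PowerSeries ℤ_[p]) • x) (ι b) = toDual x (ι ((P : PowerSeries ℤ_[p]) • b)) := by
  have hs : p ^ N • ι b = 0 := by rw [← map_nsmul, hb, map_zero]
  induction P using Polynomial.induction_on' with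
  | add P Q hP hQ =>
    rw [Polynomial.coe_add, add_smul, map_add, AddMonoidHom.add_apply, hP, hQ, add_smul, map_add, map_add]
  | monomial j c =>
    rw [← Polynomial.C_mul_X_pow_eq_monomial, Polynomial.coe_mul, Polynomial.coe_pow, Polynomial.coe_C,
      Polynomial.coe_X, mul_smul, h.C_smul _ _ (ι b) N hs, h.X_pow_smul, mul_smul]
    have hb' : p ^ N • ((PowerSeries.X : PowerSeries ℤ_[p]) ^ j • b) = 0 := by
      rw [smul_comm, hb, smul_zero]
    rw [PowerSeries.C_smul_eq_val_smul_of_pow_smul_eq_zero c hb', map_nsmul, map_nsmul,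
      apply_X_pow_smul_of_X_compat ι hT]

/-- **`Λ`-compatibility from `T`-compatibility.** For a dual pair `(X, S, ψ, toDual)` over `Λ = ℤ_p⟦T⟧`, an honest
`Λ`-module `B` whose elements are killed by powers of `p` and of `T`, and an additive `ι : B → S` with
`ι (T • b) = ψ (ι b)`: `toDual (f • x) (ι b) = toDual x (ι (f • b))` for every `f ∈ Λ`.
[cite: GreenbergLNM1716, §1 p. 60] [cite: Lang1990, Ch. 5 §1] -/
theorem toDual_smul_apply_eq_of_X_compat (h : IsDualPair p ψ toDual)
    (hT : ∀ b : B, ι ((PowerSeries.X : PowerSeries ℤ_[p]) • b) = ψ (ι b))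
    (htor : ∀ b : B, ∃ N : ℕ, p ^ N • b = 0 ∧ (PowerSeries.X : PowerSeries ℤ_[p]) ^ N • b = 0)
    (f : PowerSeries ℤ_[p]) (x : X) (b : B) :
    toDual (f • x) (ι b) = toDual x (ι (f • b)) := by
  obtain ⟨N, hpN, hXN⟩ := htor b
  have hs : ι b ∈ piece p ψ N :=
    ⟨by rw [← map_nsmul, hpN, map_zero], by rw [← apply_X_pow_smul_of_X_compat ι hT, hXN, map_zero]⟩
  rw [h.toDual_smul_eq_toDual_trunc_smul f x hs]
  have hdvd : (PowerSeries.X : PowerSeries ℤ_[p]) ^ N ∣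
      f - ((PowerSeries.trunc N f : Polynomial ℤ_[p]) : PowerSeries ℤ_[p]) :=
    PowerSeries.X_pow_dvd_iff.mpr fun m hm ↦ by
      rw [map_sub, Polynomial.coeff_coe, PowerSeries.coeff_trunc, if_pos hm, sub_self]
  obtain ⟨g, hg⟩ := hdvd
  have hf : f • b = ((PowerSeries.trunc N f : Polynomial ℤ_[p]) : PowerSeries ℤ_[p]) • b := by
    rw [← sub_eq_zero, ← sub_smul, hg, mul_comm, mul_smul, hXN, smul_zero]
  rw [hf]
  exact toDual_coe_polynomial_smul_apply_eq ι h hT _ x b hpN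

end Literature.NumberTheory.EllipticCurves.IwasawaDual.IsDualPair

namespace WeierstrassCurve.SelmerDualData

open Literature.NumberTheory.EllipticCurves

variable {K : Type} [Field K] [NumberField K] {W : WeierstrassCurve K} {p : ℕ} [Fact p.Prime]
  {κ : ZpExtension K p} {γ : Field.absoluteGaloisGroup K} (D : W.SelmerDualData κ γ)

/-- **The hypothesis `hιΛ` of `exists_linearMap_quotSMulTop_qm_characterModule` from `T`-compatibility alone**: for
`X(E/K_∞) ↔ Sel_{p^∞}(E/K_∞)` (`ψ = conj_γ − 1`, `γ` a topological generator), an honest `Λ`-module `B` of `p`- and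
`T`-power torsion and an additive `ι : B → Sel_∞` with `ι (T • b) = (conj_γ − 1)(ι b)`:
`⟨f • x, ι b⟩ = ⟨x, ι (f • b)⟩` for all `f ∈ Λ`. [cite: GreenbergLNM1716, §1 p. 60 and §4 p. 98] [cite: Lang1990, Ch. 5 §1] -/
theorem toDual_smul_apply_eq_of_X_compat (hγ : κ.IsTopGenerator γ) {B : Type*} [AddCommGroup B]
    [Module (IwasawaAlgebra p) B] (ι : B →+ W.selmerInfty κ)
    (hT : ∀ b : B, ι ((PowerSeries.X : IwasawaAlgebra p) • b) = (W.conjSelmerInfty κ γ - 1) (ι b))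
    (htor : ∀ b : B, ∃ N : ℕ, p ^ N • b = 0 ∧ (PowerSeries.X : IwasawaAlgebra p) ^ N • b = 0)
    (f : IwasawaAlgebra p) (x : D.X) (b : B) :
    D.toDual (f • x) (ι b) = D.toDual x (ι (f • b)) :=
  (D.isDualPair W hγ).toDual_smul_apply_eq_of_X_compat ι hT htor f x b

end WeierstrassCurve.SelmerDualData

end
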